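import Summits.CriticalPhenomena.PercolationContinuityZ3.Theorems.PercNearOneGluingAdditiveGluingKillSetTransfer
import Summits.CriticalPhenomena.PercolationContinuityZ3.Theorems.PercNearOneGluingAdditiveGluingGoodStep24Glue
import HarnessLib

/-! # Crux `PercNearOneGluing.AdditiveGluing` (stmt-CriticalPhenomena-4576), stub `stub_goodStep` — Lemma Ω (`pocket_exchange`, STUB-PLAN H1)

Stub-plan prover; completes the SPINE of `STUB-PLAN-stub_goodStep.md` §2 (H2, H3 landed in `…BlockGrowth.lean`).  Lands
`--supports stmt-CriticalPhenomena-4576`; no definitions, no named facts.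

**Lemma Ω (`pocket_exchange`).**  `μ = prodBernoulli u`; relays `A ∋ b`; a block `S ≠ ∅` with cluster `K_S = ⋃_{s∈S} C(s)` and
dead-pocket credit `pockS(S, sel) = Σ_{W ∩ A = ∅} μ(K_S = W) · μ(sel W ↔ b in Wᶜ)`; a vertex `u₁`.  If the quadruple
`(u − W, A, u₁, b)` is GOOD (Kozma–Nitzan's good-quadruple inequality in the skeleton's selection form, all levels and selections)
for every dead `W ⊇ S` not containing `u₁` — these are induction-hypothesis instances of `stub_goodStep` (`u − W` = the pairs
meeting `W` killed) — then for every selection `sel'` there is a selection `sel` with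
`pockS(S, sel) ≤ pockS(S ∪ {u₁}, sel') + μ(K_S dead, u₁ ∉ K_S, u₁ ↔ b)`:
growing the block by `u₁` loses at most the mass of `{u₁ ↔ b}` on the dead pockets of `S` avoiding `u₁`, up to re-selection.
Proof (plan §2 H1): on `{K_S = W}` (`W` dead, `u₁ ∉ W`) the outside is `u − W`-percolation (pocket Markov for blocks,
`blockPocket_markov`, and the kill-set transfers of `…KillSetTransfer.lean`); the `W`-term of the loss is the success form of
`GOOD(u − W, A, u₁, b)` at the relay `sel W := argmin_A μ_{u−W}(· ↔ b)` (`goodStep24_clean_singleton`); the pockets `C` of `u₁` in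
`u − W` re-assemble with `W` into the pockets `W ∪ C` of `S ∪ {u₁}`; on `W ∋ u₁` keep `sel W := sel' W`.
Together with H2 (`blockGrowth_gap_insert`) this is the exact block-growth calculus
`BG-slack(S ∪ u₁) = BG-slack(S) + μ(S↮b, a₀↮S, u₁↔b) − μ(S↔b, u₁↮b, a₀↔u₁, a₀↮S) − ΔP`, `ΔP ≤ μ(K_S dead, u₁ ∉ K_S, u₁ ↔ b)`.
[cite: KozmaNitzan2024, §3.2 (Definition p. 12; proof of Thm 5, p. 14)]
-/

namespace Summit.CriticalPhenomena.PercolationContinuityZ3.Theorems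

open MeasureTheory Set Filter
open Literature.Probability.LatticeModels (prodBernoulli)
open Literature.Probability.Percolation (BondConfig openConn openConnIn openGraph openCluster)
open scoped BigOperators

noncomputable section
open Classical

section PocketExchange

open Literature.Probability.LatticeModels Literature.Probability.Percolation

variable {n : ℕ}

/-- On `{K_S = W}` with `u₁ ∈ W`, the cluster of `S ∪ {u₁}` is also `W`. [folklore] -/
theorem blockPocket_subset_insert_of_mem (S W : Finset (Fin n)) (u₁ : Fin n) (hu₁ : u₁ ∈ W) :
    {ω : BondConfig (Fin n) | ∀ z : Fin n, (z ∈ W ↔ ω ∈ ⋃ s ∈ S, openConn s z)} ⊆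
      {ω : BondConfig (Fin n) | ∀ z : Fin n, (z ∈ W ↔ ω ∈ ⋃ s ∈ insert u₁ S, openConn s z)} := by
  intro ω hω z
  rw [Finset.set_biUnion_insert, Set.mem_union]
  refine ⟨fun hz => Or.inr ((hω z).1 hz), ?_⟩
  rintro (hz | hz)
  · obtain ⟨s, hs, hsu⟩ := Set.mem_iUnion₂.1 ((hω u₁).1 hu₁)
    exact (hω z).2 (Set.mem_iUnion₂.2 ⟨s, hs, (show (openGraph ω).Reachable s u₁ from hsu).trans hz⟩)
  · exact (hω z).2 hz

/-- On `{K_S = W}` with `u₁ ∉ W`, if the pocket of `u₁` inside `Wᶜ` is `C` then the cluster of `S ∪ {u₁}` is `W ∪ C`. [folklore] -/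
theorem blockPocket_inter_pocketIn_subset (S W C : Finset (Fin n)) (u₁ : Fin n) (hu₁ : u₁ ∉ W) :
    {ω : BondConfig (Fin n) | ∀ z : Fin n, (z ∈ W ↔ ω ∈ ⋃ s ∈ S, openConn s z)} ∩
        {ω : BondConfig (Fin n) | ∀ x : Fin n, (x ∈ C ↔ ω ∈ openConnIn ((W : Set (Fin n))ᶜ) u₁ x)} ⊆
      {ω : BondConfig (Fin n) | ∀ z : Fin n, (z ∈ W ∪ C ↔ ω ∈ ⋃ s ∈ insert u₁ S, openConn s z)} := by
  rintro ω ⟨hW, hC⟩ z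
  rw [Finset.set_biUnion_insert, Set.mem_union, Finset.mem_union]
  constructor
  · rintro (hz | hz)
    · exact Or.inr ((hW z).1 hz)
    · exact Or.inl (reachable_of_mem_openConnIn ((hC z).1 hz))
  · rintro (hz | hz)
    · by_cases hzW : z ∈ W
      · exact Or.inl hzW
      · refine Or.inr ((hC z).2 ?_)
        have h := (Set.ext_iff.1 (blockPocket_inter_openConn S W u₁ z hu₁) ω).1 ⟨hW, hz⟩
        exact h.2
    · exact Or.inl ((hW z).2 hz)

/-- **Lemma Ω (`pocket_exchange`)** — see the module docstring. [cite: KozmaNitzan2024, §3.2 (Definition p. 12; proof of Thm 5, p. 14)] -/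
theorem pocket_exchange (u : Sym2 (Fin n) → unitInterval) (A S : Finset (Fin n)) (b u₁ : Fin n)
    (hbA : b ∈ A) (hS : S.Nonempty)
    (hIH : ∀ W : Finset (Fin n), S ⊆ W → Disjoint W A → u₁ ∉ W →
      ∀ (t : ℝ) (sel : Finset (Fin n) → Fin n), (∀ W', sel W' ∈ A) →
        (∀ a ∈ A, 1 - t ≤ (prodBernoulli (fun e : Sym2 (Fin n) =>
          if ∃ x ∈ W, x ∈ e then (0 : unitInterval) else u e)).real (openConn a b)) →
        (prodBernoulli (fun e : Sym2 (Fin n) => if ∃ x ∈ W, x ∈ e then (0 : unitInterval) else u e)).real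
            ((⋃ a ∈ A, openConn u₁ a) ∩ (openConn u₁ b)ᶜ)
          + ∑ W' ∈ (Finset.univ : Finset (Finset (Fin n))).filter (fun W' => u₁ ∈ W' ∧ Disjoint W' A),
              (prodBernoulli (fun e : Sym2 (Fin n) => if ∃ x ∈ W, x ∈ e then (0 : unitInterval) else u e)).real
                  {ω : BondConfig (Fin n) | openCluster ω u₁ = (W' : Set (Fin n))}
                * (prodBernoulli (fun e : Sym2 (Fin n) => if ∃ x ∈ W, x ∈ e then (0 : unitInterval) else u e)).real
                    (openConnIn ((W' : Set (Fin n))ᶜ) (sel W') b)ᶜ ≤ t)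
    (sel' : Finset (Fin n) → Fin n) (hsel' : ∀ W, sel' W ∈ A) :
    ∃ sel : Finset (Fin n) → Fin n, (∀ W, sel W ∈ A) ∧
      ∑ W ∈ (Finset.univ : Finset (Finset (Fin n))).filter (fun W => Disjoint W A),
          (prodBernoulli u).real {ω : BondConfig (Fin n) | ∀ z : Fin n, (z ∈ W ↔ ω ∈ ⋃ s ∈ S, openConn s z)}
            * (prodBernoulli u).real (openConnIn ((W : Set (Fin n))ᶜ) (sel W) b) ≤
        ∑ W ∈ (Finset.univ : Finset (Finset (Fin n))).filter (fun W => Disjoint W A),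
          (prodBernoulli u).real {ω : BondConfig (Fin n) | ∀ z : Fin n, (z ∈ W ↔ ω ∈ ⋃ s ∈ insert u₁ S, openConn s z)}
            * (prodBernoulli u).real (openConnIn ((W : Set (Fin n))ᶜ) (sel' W) b)
        + (prodBernoulli u).real ((⋃ s ∈ S, ⋃ a ∈ A, openConn s a)ᶜ ∩ (⋃ s ∈ S, openConn s u₁)ᶜ ∩ openConn u₁ b) := by
  set μ := prodBernoulli u with hμ
  -- the per-pocket relay `a_W = argmin_A μ_{u−W}(· ↔ b)`
  have hex : ∀ W : Finset (Fin n), ∃ a ∈ A, ∀ a' ∈ A,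
      (prodBernoulli (fun e : Sym2 (Fin n) => if ∃ x ∈ W, x ∈ e then (0 : unitInterval) else u e)).real (openConn a b) ≤
      (prodBernoulli (fun e : Sym2 (Fin n) => if ∃ x ∈ W, x ∈ e then (0 : unitInterval) else u e)).real (openConn a' b) :=
    fun W => Finset.exists_min_image A _ ⟨b, hbA⟩
  choose aW haW hminW using hex
  refine ⟨fun W => if u₁ ∈ W then sel' W else aW W, fun W => by
    show (if u₁ ∈ W then sel' W else aW W) ∈ A
    split_ifs
    · exact hsel' W
    · exact haW W, ?_⟩
  -- notation
  set 𝒟 : Finset (Finset (Fin n)) := (Finset.univ : Finset (Finset (Fin n))).filter (fun W => Disjoint W A) with h𝒟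
  set KWS : Finset (Fin n) → Set (BondConfig (Fin n)) :=
    fun W => {ω : BondConfig (Fin n) | ∀ z : Fin n, (z ∈ W ↔ ω ∈ ⋃ s ∈ S, openConn s z)} with hKWS
  set KWT : Finset (Fin n) → Set (BondConfig (Fin n)) :=
    fun W => {ω : BondConfig (Fin n) | ∀ z : Fin n, (z ∈ W ↔ ω ∈ ⋃ s ∈ insert u₁ S, openConn s z)} with hKWT
  set f : Finset (Fin n) → ℝ := fun W => μ.real (openConnIn ((W : Set (Fin n))ᶜ) (sel' W) b) with hf
  set E₁ : Set (BondConfig (Fin n)) := openConn u₁ b ∩ (⋃ s ∈ S, openConn s u₁)ᶜ with hE₁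
  have hmem𝒟 : ∀ W, W ∈ 𝒟 ↔ Disjoint W A := fun W => by simp [h𝒟]
  have hf0 : ∀ W, 0 ≤ f W := fun W => measureReal_nonneg
  have hg0 : ∀ W W'', 0 ≤ μ.real (KWS W ∩ KWT W'') * f W'' := fun W W'' => mul_nonneg measureReal_nonneg (hf0 W'')
  -- (**) the per-pocket inequality
  have hkey : ∀ W ∈ 𝒟,
      μ.real (KWS W) * μ.real (openConnIn ((W : Set (Fin n))ᶜ) (if u₁ ∈ W then sel' W else aW W) b) ≤
        μ.real (KWS W ∩ E₁) + ∑ W'' ∈ 𝒟, μ.real (KWS W ∩ KWT W'') * f W'' := by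
    intro W hW
    have hWA : Disjoint W A := (hmem𝒟 W).1 hW
    by_cases hu₁W : u₁ ∈ W
    · -- `u₁ ∈ W`: `{K_S = W} ⊆ {K_T = W}`, keep the selection
      rw [if_pos hu₁W]
      have h1 : μ.real (KWS W) ≤ μ.real (KWS W ∩ KWT W) :=
        measureReal_mono (fun ω hω => ⟨hω, blockPocket_subset_insert_of_mem S W u₁ hu₁W hω⟩) (measure_ne_top _ _)
      have h2 : μ.real (KWS W ∩ KWT W) * f W ≤ ∑ W'' ∈ 𝒟, μ.real (KWS W ∩ KWT W'') * f W'' :=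
        Finset.single_le_sum (fun W'' _ => hg0 W W'') hW
      have h3 : 0 ≤ μ.real (KWS W ∩ E₁) := measureReal_nonneg
      calc μ.real (KWS W) * μ.real (openConnIn ((W : Set (Fin n))ᶜ) (sel' W) b)
          ≤ μ.real (KWS W ∩ KWT W) * f W := mul_le_mul_of_nonneg_right h1 (hf0 W)
        _ ≤ _ := by linarith
    · rw [if_neg hu₁W]
      by_cases hSW : S ⊆ W
      swap
      · -- `S ⊄ W`: the pocket is empty
        obtain ⟨s₀, hs₀S, hs₀W⟩ := Finset.not_subset.1 hSW
        have h0 : μ.real (KWS W) = 0 := by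
          simp only [hKWS]; rw [blockPocket_eq_empty S W s₀ hs₀S hs₀W, measureReal_empty]
        rw [h0, zero_mul]
        exact add_nonneg measureReal_nonneg (Finset.sum_nonneg fun W'' _ => hg0 W W'')
      -- `S ⊆ W`, `u₁ ∉ W`: the GOOD instance in success form
      set K : Sym2 (Fin n) → unitInterval := fun e => if ∃ x ∈ W, x ∈ e then (0 : unitInterval) else u e with hK
      have haWW : aW W ∉ W := fun h => Finset.disjoint_left.1 hWA h (haW W)
      have hG := goodStep24_clean_singleton K A u₁ b (aW W) (fun C => sel' (W ∪ C)) hbA (fun C => hsel' _)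
        (hminW W) (hIH W hSW hWA hu₁W)
      rw [goodStep24_glue_singleton K u₁] at hG
      simp only [Finset.set_biUnion_singleton] at hG
      -- transfer each term to `μ`
      set m := μ.real (KWS W) with hm
      have hm0 : 0 ≤ m := measureReal_nonneg
      have t1 : μ.real (openConnIn ((W : Set (Fin n))ᶜ) (aW W) b) = (prodBernoulli K).real (openConn (aW W) b) :=
        (killSet_real_openConn_eq_offConn u W (aW W) b haWW).symm
      have t2 : m * (prodBernoulli K).real (openConn u₁ b) ≤ μ.real (KWS W ∩ E₁) := by
        rw [killSet_real_openConn_eq_offConn u W u₁ b hu₁W, hm, blockPocket_mul_offConn u S W hS u₁ b hu₁W]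
        refine measureReal_mono (fun ω hω => ⟨hω.1, hω.2, fun hu => hu₁W ?_⟩) (measure_ne_top _ _)
        obtain ⟨s, hs, hsu⟩ := Set.mem_iUnion₂.1 hu
        exact (hω.1 u₁).2 (Set.mem_iUnion₂.2 ⟨s, hs, hsu⟩)
      have t3 : ∀ C ∈ 𝒟,
          m * ((prodBernoulli K).real {ω : BondConfig (Fin n) | ∀ x : Fin n, (x ∈ C ↔ ω ∈ openConn u₁ x)}
            * (prodBernoulli K).real (openConnIn ((C : Set (Fin n))ᶜ) (sel' (W ∪ C)) b)) ≤
          if Disjoint C W then μ.real (KWS W ∩ KWT (W ∪ C)) * f (W ∪ C) else 0 := by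
        intro C hC
        have hCA : Disjoint C A := (hmem𝒟 C).1 hC
        have ha'W : sel' (W ∪ C) ∉ W := fun h => Finset.disjoint_left.1 hWA h (hsel' _)
        by_cases hCW : Disjoint C W
        · rw [if_pos hCW, killSet_real_pocket_eq u W C u₁ hu₁W,
            killSet_real_eq_of_determinedBy u W _ (determinedBy_pocketIn W C u₁),
            killSet_real_openConnIn_eq u W C (sel' (W ∪ C)) b ha'W,
            killSet_real_eq_of_determinedBy u W _
              ((offObs_determinedBy_openConnIn_compl (W ∪ C) (sel' (W ∪ C)) b).mono (fun e he => ?_)),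
            ← mul_assoc, hm, ← blockPocket_markov u S W hS _ (determinedBy_pocketIn W C u₁)]
          · refine mul_le_mul_of_nonneg_right (measureReal_mono ?_ (measure_ne_top _ _)) (hf0 _)
            exact fun ω hω => ⟨hω.1, blockPocket_inter_pocketIn_subset S W C u₁ hu₁W hω⟩
          · simp only [Finset.coe_filter, Finset.mem_univ, true_and, Set.mem_setOf_eq, Finset.mem_union] at he ⊢
            exact fun v hv h' => he v hv (Or.inl h')
        · rw [if_neg hCW]
          obtain ⟨x₀, hx₀C, hx₀W⟩ := Finset.not_disjoint_iff.1 hCW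
          have h0 : (prodBernoulli K).real {ω : BondConfig (Fin n) | ∀ x : Fin n, (x ∈ C ↔ ω ∈ openConn u₁ x)} = 0 := by
            refine le_antisymm ?_ measureReal_nonneg
            have h1 : (prodBernoulli K).real (openConn u₁ x₀) = 0 := by
              rw [killSet_real_openConn_eq_offConn u W u₁ x₀ hu₁W]
              have : (openConnIn ((W : Set (Fin n))ᶜ) u₁ x₀ : Set (BondConfig (Fin n))) = ∅ :=
                Set.eq_empty_of_forall_notMem fun ω hω => hω.2.1 (Finset.mem_coe.2 hx₀W)
              rw [this, measureReal_empty]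
            rw [← h1]
            exact measureReal_mono (fun ω hω => (hω x₀).1 hx₀C) (measure_ne_top _ _)
          rw [h0, zero_mul, mul_zero]
      -- sum of the pocket terms, re-indexed by `W'' = W ∪ C`
      have t4 : ∑ C ∈ 𝒟, (if Disjoint C W then μ.real (KWS W ∩ KWT (W ∪ C)) * f (W ∪ C) else 0) ≤
          ∑ W'' ∈ 𝒟, μ.real (KWS W ∩ KWT W'') * f W'' := by
        rw [← Finset.sum_filter]
        have hinj : Set.InjOn (fun C => W ∪ C) ↑(𝒟.filter fun C => Disjoint C W) := by
          intro C₁ hC₁ C₂ hC₂ heq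
          have h1 : Disjoint C₁ W := (Finset.mem_filter.1 (Finset.mem_coe.1 hC₁)).2
          have h2 : Disjoint C₂ W := (Finset.mem_filter.1 (Finset.mem_coe.1 hC₂)).2
          ext x
          constructor
          · intro hx
            have : x ∈ W ∪ C₂ := by rw [← show W ∪ C₁ = W ∪ C₂ from heq]; exact Finset.mem_union_right _ hx
            rcases Finset.mem_union.1 this with hxW | hx2
            · exact absurd hxW (Finset.disjoint_left.1 h1 hx)
            · exact hx2
          · intro hx
            have : x ∈ W ∪ C₁ := by rw [show W ∪ C₁ = W ∪ C₂ from heq]; exact Finset.mem_union_right _ hx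
            rcases Finset.mem_union.1 this with hxW | hx1
            · exact absurd hxW (Finset.disjoint_left.1 h2 hx)
            · exact hx1
        rw [← Finset.sum_image (f := fun W'' => μ.real (KWS W ∩ KWT W'') * f W'') hinj]
        refine Finset.sum_le_sum_of_subset_of_nonneg (fun W'' hW'' => ?_) (fun W'' _ _ => hg0 W W'')
        obtain ⟨C, hC, rfl⟩ := Finset.mem_image.1 hW''
        have hCA : Disjoint C A := (hmem𝒟 C).1 (Finset.mem_filter.1 hC).1
        exact (hmem𝒟 _).2 (Finset.disjoint_union_left.2 ⟨hWA, hCA⟩)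
      -- assemble the per-pocket inequality
      have hsum3 : m * ∑ C ∈ 𝒟, ((prodBernoulli K).real {ω : BondConfig (Fin n) | ∀ x : Fin n, (x ∈ C ↔ ω ∈ openConn u₁ x)}
            * (prodBernoulli K).real (openConnIn ((C : Set (Fin n))ᶜ) (sel' (W ∪ C)) b)) ≤
          ∑ W'' ∈ 𝒟, μ.real (KWS W ∩ KWT W'') * f W'' := by
        rw [Finset.mul_sum]
        exact (Finset.sum_le_sum t3).trans t4
      calc m * μ.real (openConnIn ((W : Set (Fin n))ᶜ) (aW W) b)
          = m * (prodBernoulli K).real (openConn (aW W) b) := by rw [t1]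
        _ ≤ m * ((prodBernoulli K).real (openConn u₁ b)
              + ∑ C ∈ 𝒟, (prodBernoulli K).real {ω : BondConfig (Fin n) | ∀ x : Fin n, (x ∈ C ↔ ω ∈ openConn u₁ x)}
                  * (prodBernoulli K).real (openConnIn ((C : Set (Fin n))ᶜ) (sel' (W ∪ C)) b)) :=
            mul_le_mul_of_nonneg_left hG hm0
        _ ≤ μ.real (KWS W ∩ E₁) + ∑ W'' ∈ 𝒟, μ.real (KWS W ∩ KWT W'') * f W'' := by
            rw [mul_add]; exact add_le_add t2 hsum3
  -- sum (**) over the dead pockets of `S`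
  have hsumE : ∑ W ∈ 𝒟, μ.real (KWS W ∩ E₁) ≤
      μ.real ((⋃ s ∈ S, ⋃ a ∈ A, openConn s a)ᶜ ∩ (⋃ s ∈ S, openConn s u₁)ᶜ ∩ openConn u₁ b) := by
    simp only [hKWS, h𝒟]
    rw [blockPocket_sum_dead u S A E₁]
    refine measureReal_mono (fun ω hω => ?_) (measure_ne_top _ _)
    simp only [hE₁, Set.mem_inter_iff, Set.mem_compl_iff, Set.mem_setOf_eq, Set.mem_iUnion, exists_prop, not_exists,
      not_and] at hω ⊢
    exact ⟨⟨fun s hs a ha h => hω.2 a ha s hs h, hω.1.2⟩, hω.1.1⟩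
  have hsumT : ∀ W'' ∈ 𝒟, ∑ W ∈ 𝒟, μ.real (KWS W ∩ KWT W'') * f W'' ≤ μ.real (KWT W'') * f W'' := by
    intro W'' _
    rw [← Finset.sum_mul]
    refine mul_le_mul_of_nonneg_right ?_ (hf0 W'')
    simp only [hKWS, h𝒟]
    rw [blockPocket_sum_dead u S A (KWT W'')]
    exact measureReal_mono Set.inter_subset_left (measure_ne_top _ _)
  calc ∑ W ∈ 𝒟, μ.real (KWS W) * μ.real (openConnIn ((W : Set (Fin n))ᶜ) (if u₁ ∈ W then sel' W else aW W) b)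
      ≤ ∑ W ∈ 𝒟, (μ.real (KWS W ∩ E₁) + ∑ W'' ∈ 𝒟, μ.real (KWS W ∩ KWT W'') * f W'') := Finset.sum_le_sum hkey
    _ = ∑ W ∈ 𝒟, μ.real (KWS W ∩ E₁) + ∑ W'' ∈ 𝒟, ∑ W ∈ 𝒟, μ.real (KWS W ∩ KWT W'') * f W'' := by
        rw [Finset.sum_add_distrib, Finset.sum_comm]
    _ ≤ μ.real ((⋃ s ∈ S, ⋃ a ∈ A, openConn s a)ᶜ ∩ (⋃ s ∈ S, openConn s u₁)ᶜ ∩ openConn u₁ b)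
          + ∑ W'' ∈ 𝒟, μ.real (KWT W'') * f W'' := add_le_add hsumE (Finset.sum_le_sum hsumT)
    _ = _ := by rw [add_comm]

end PocketExchange

open Literature.Probability.LatticeModels Literature.Probability.Percolation in
/-- Registered helper stub `stub_pocketExchange_sp` (stub-plan prover; STUB-PLAN H1): **Lemma Ω** — growing a block by one
vertex loses at most `μ(K_S dead, u₁ ∉ K_S, u₁ ↔ b)` of dead-pocket credit, up to re-selection, given the GOOD induction-hypothesis
instances for `u₁` in the graphs with the dead pockets of `S` killed (= `pocket_exchange`). [cite: KozmaNitzan2024, §3.2 (Definition p. 12; proof of Thm 5, p. 14)] -/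
theorem stub_pocketExchange_sp : ∀ (n : ℕ) (u : Sym2 (Fin n) → unitInterval) (A S : Finset (Fin n)) (b u₁ : Fin n), b ∈ A → S.Nonempty → (∀ W : Finset (Fin n), S ⊆ W → Disjoint W A → u₁ ∉ W → ∀ (t : ℝ) (sel : Finset (Fin n) → Fin n), (∀ W', sel W' ∈ A) → (∀ a ∈ A, 1 - t ≤ (prodBernoulli (fun e : Sym2 (Fin n) => if ∃ x ∈ W, x ∈ e then (0 : unitInterval) else u e)).real (openConn a b)) → (prodBernoulli (fun e : Sym2 (Fin n) => if ∃ x ∈ W, x ∈ e then (0 : unitInterval) else u e)).real ((⋃ a ∈ A, openConn u₁ a) ∩ (openConn u₁ b)ᶜ) + ∑ W' ∈ (Finset.univ : Finset (Finset (Fin n))).filter (fun W' => u₁ ∈ W' ∧ Disjoint W' A), (prodBernoulli (fun e : Sym2 (Fin n) => if ∃ x ∈ W, x ∈ e then (0 : unitInterval) else u e)).real {ω : BondConfig (Fin n) | openCluster ω u₁ = (W' : Set (Fin n))} * (prodBernoulli (fun e : Sym2 (Fin n) => if ∃ x ∈ W, x ∈ e then (0 : unitInterval) else u e)).real (openConnIn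 ((W' : Set (Fin n))ᶜ) (sel W') b)ᶜ ≤ t) → ∀ (sel' : Finset (Fin n) → Fin n), (∀ W, sel' W ∈ A) → ∃ sel : Finset (Fin n) → Fin n, (∀ W, sel W ∈ A) ∧ ∑ W ∈ (Finset.univ : Finset (Finset (Fin n))).filter (fun W => Disjoint W A), (prodBernoulli u).real {ω : BondConfig (Fin n) | ∀ z : Fin n, (z ∈ W ↔ ω ∈ ⋃ s ∈ S, openConn s z)} * (prodBernoulli u).real (openConnIn ((W : Set (Fin n))ᶜ) (sel W) b) ≤ ∑ W ∈ (Finset.univ : Finset (Finset (Fin n))).filter (fun W => Disjoint W A), (prodBernoulli u).real {ω : BondConfig (Fin n) | ∀ z : Fin n, (z ∈ W ↔ ω ∈ ⋃ s ∈ insert u₁ S, openConn s z)} * (prodBernoulli u).real (openConnIn ((W : Set (Fin n))ᶜ) (sel' W) b) + (prodBernoulli u).real ((⋃ s ∈ S, ⋃ a ∈ A, openConn s a)ᶜ ∩ (⋃ s ∈ S, openConn s u₁)ᶜ ∩ openConn u₁ b) :=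
  fun _ u A S b u₁ hbA hS hIH sel' hsel' => pocket_exchange u A S b u₁ hbA hS hIH sel' hsel'

end

end Summit.CriticalPhenomena.PercolationContinuityZ3.Theorems
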